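import Literature.MathematicalPhysics.KineticTheory.HardSphereGainExchangeAxis
import Literature.MathematicalPhysics.KineticTheory.LinearLorentzBoltzmannDuality
import Mathlib.Analysis.InnerProductSpace.Projection.Reflection
import HarnessLib

/-!
# The exchange symmetry of the three-dimensional hard-sphere gain term, III: general relative
velocity; the two gain terms coincide

For `V ∈ ℝ³ = EuclideanSpace ℝ (Fin 3)` and measurable `G ≥ 0`,

`∫_{S²} (V·ω)₊ G((V·ω) ω) dσ(ω) = ∫_{S²} (V·ω)₊ G(V - (V·ω) ω) dσ(ω)`
(`lintegral_sphere_gain_exchange`),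

reduced to the axis version of `HardSphereGainExchangeAxis` by the reflection exchanging `e₂` and
`V/|V|` (`Submodule.reflection_sub`), the invariance of the surface measure under linear isometries
(`measurePreserving_restrict_sphere`) and scaling. Since `(V·ω) ω = v_*' - v_*` and
`V - (V·ω) ω = v' - v_*` for the hard-sphere collision `collide ω (v, v_*)` with `V = v - v_*`, the
two post-collisional velocities are equidistributed under `((v - v_*)·ω)₊ dω`
(`lintegral_hardSphere_gain_exchange`), and the two gain terms
`∫∫ B m(v_*) U(v_*') dω dμ(v_*) = ∫∫ B m(v_*) U(v') dω dμ(v_*)` of the (linearised) hard-sphere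
operator coincide pointwise in `v` (`lintegral_lintegral_hardSphere_gain_exchange`) — the
three-dimensional identity `K₂'' = K₂'` behind Grad's/Hilbert's kernel form of the gain operator
(CIP 1994 §7.2 (2.14)–(2.16)). No new definitions are introduced.
-/

open MeasureTheory Metric Set Filter Real
open scoped ENNReal InnerProductSpace

namespace Literature.MathematicalPhysics.KineticTheory

noncomputable section

/-! ### The exchange identity for a general relative velocity -/

/-- **Exchange symmetry of the hard-sphere gain term in `ℝ³`.** For every `V ∈ ℝ³` and measurable
`G ≥ 0`, `∫_{S²} (V·ω)₊ G((V·ω) ω) dσ(ω) = ∫_{S²} (V·ω)₊ G(V - (V·ω) ω) dσ(ω)`: the two velocity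
transfers `(V·ω) ω = v_*' - v_*` and `V - (V·ω) ω = v' - v_*` of a hard-sphere collision with
relative velocity `V` are equidistributed under `(V·ω)₊ dω` (dimension `3` only). Reduction to the
axis version `lintegral_sphere_gain_exchange_axis` by the reflection exchanging `e₂` and `V/|V|`
(`Submodule.reflection_sub`; the surface measure is invariant under linear isometries,
`measurePreserving_restrict_sphere`) and by scaling. [folklore] -/
theorem lintegral_sphere_gain_exchange (V : EuclideanSpace ℝ (Fin 3))
    {G : EuclideanSpace ℝ (Fin 3) → ℝ≥0∞} (hG : Measurable G) :
    ∫⁻ ω : sphere (0 : EuclideanSpace ℝ (Fin 3)) 1,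
        ENNReal.ofReal (max ⟪V, (ω : EuclideanSpace ℝ (Fin 3))⟫_ℝ 0) *
          G (⟪V, (ω : EuclideanSpace ℝ (Fin 3))⟫_ℝ • (ω : EuclideanSpace ℝ (Fin 3))) ∂sphereMeasure =
      ∫⁻ ω : sphere (0 : EuclideanSpace ℝ (Fin 3)) 1,
        ENNReal.ofReal (max ⟪V, (ω : EuclideanSpace ℝ (Fin 3))⟫_ℝ 0) *
          G (V - ⟪V, (ω : EuclideanSpace ℝ (Fin 3))⟫_ℝ • (ω : EuclideanSpace ℝ (Fin 3))) ∂sphereMeasure := by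
  by_cases hV : V = 0
  · simp [hV]
  set e : EuclideanSpace ℝ (Fin 3) := EuclideanSpace.single 2 (1 : ℝ) with he_def
  have he : ‖e‖ = 1 := by simp [he_def]
  set t : ℝ := ‖V‖ with ht_def
  have ht : 0 < t := norm_pos_iff.2 hV
  set u : EuclideanSpace ℝ (Fin 3) := t⁻¹ • V with hu_def
  have hu : ‖u‖ = 1 := by
    rw [hu_def, norm_smul, norm_inv, Real.norm_of_nonneg ht.le, inv_mul_cancel₀ ht.ne']
  have hVu : V = t • u := by rw [hu_def, smul_smul, mul_inv_cancel₀ ht.ne', one_smul]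
  -- the reflection exchanging `e` and `u`
  set A : EuclideanSpace ℝ (Fin 3) ≃ₗᵢ[ℝ] EuclideanSpace ℝ (Fin 3) :=
    (Submodule.span ℝ {e - u})ᗮ.reflection with hA_def
  have hAe : A e = u := Submodule.reflection_sub (he.trans hu.symm)
  have hAu : A u = e := by rw [← hAe, hA_def, Submodule.reflection_reflection]
  have hAV : A V = t • e := by rw [hVu, map_smul, hAu]
  have hAAV : A (A V) = V := by rw [hA_def]; exact Submodule.reflection_reflection _ V
  have hinnerA : ∀ ω' : EuclideanSpace ℝ (Fin 3), ⟪V, A ω'⟫_ℝ = t * ⟪ω', e⟫_ℝ := fun ω' => by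
    rw [← hAAV, A.inner_map_map, hAV, real_inner_smul_left, real_inner_comm]
  -- change of variables `ω = A ω'` on the sphere
  set f := (mapsTo_sphere_linearIsometryEquiv A).restrict A (sphere (0 : EuclideanSpace ℝ (Fin 3)) 1)
    (sphere (0 : EuclideanSpace ℝ (Fin 3)) 1) with hf
  have hf_apply : ∀ ω', ((f ω' : sphere (0 : EuclideanSpace ℝ (Fin 3)) 1) : EuclideanSpace ℝ (Fin 3)) =
      A ω' := fun ω' => rfl
  have hcv : ∀ F : sphere (0 : EuclideanSpace ℝ (Fin 3)) 1 → ℝ≥0∞,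
      ∫⁻ ω, F ω ∂sphereMeasure = ∫⁻ ω', F (f ω') ∂sphereMeasure := fun F =>
    ((measurePreserving_restrict_sphere A).lintegral_comp_emb (measurableEmbedding_restrict_sphere A) F).symm
  -- reduce to the axis version for `G' = G ∘ A ∘ (t • ·)`
  have hG' : Measurable fun y : EuclideanSpace ℝ (Fin 3) => G (A (t • y)) :=
    hG.comp (A.continuous.measurable.comp (measurable_const_smul t))
  have hmax : ∀ ω' : sphere (0 : EuclideanSpace ℝ (Fin 3)) 1,
      ENNReal.ofReal (max (t * ⟪(ω' : EuclideanSpace ℝ (Fin 3)), e⟫_ℝ) 0) =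
        ENNReal.ofReal t * ENNReal.ofReal (max ⟪(ω' : EuclideanSpace ℝ (Fin 3)), e⟫_ℝ 0) := fun ω' => by
    rw [← ENNReal.ofReal_mul ht.le]
    congr 1
    rcases le_or_gt 0 ⟪(ω' : EuclideanSpace ℝ (Fin 3)), e⟫_ℝ with h | h
    · rw [max_eq_left (by positivity), max_eq_left h]
    · rw [max_eq_right (by nlinarith), max_eq_right h.le, mul_zero]
  have h1 : ∀ ω' : sphere (0 : EuclideanSpace ℝ (Fin 3)) 1,
      (t * ⟪(ω' : EuclideanSpace ℝ (Fin 3)), e⟫_ℝ) • A ω' =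
        A (t • (⟪(ω' : EuclideanSpace ℝ (Fin 3)), e⟫_ℝ • (ω' : EuclideanSpace ℝ (Fin 3)))) := fun ω' => by
    rw [map_smul, map_smul, smul_smul]
  have h2 : ∀ ω' : sphere (0 : EuclideanSpace ℝ (Fin 3)) 1,
      V - (t * ⟪(ω' : EuclideanSpace ℝ (Fin 3)), e⟫_ℝ) • A ω' =
        A (t • (e - ⟪(ω' : EuclideanSpace ℝ (Fin 3)), e⟫_ℝ • (ω' : EuclideanSpace ℝ (Fin 3)))) := fun ω' => by
    rw [smul_sub, map_sub, map_smul, hAe, ← hVu, map_smul, map_smul, smul_smul]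
  have hm1 : Measurable fun ω' : sphere (0 : EuclideanSpace ℝ (Fin 3)) 1 =>
      ENNReal.ofReal (max ⟪(ω' : EuclideanSpace ℝ (Fin 3)), e⟫_ℝ 0) *
        G (A (t • (⟪(ω' : EuclideanSpace ℝ (Fin 3)), e⟫_ℝ • (ω' : EuclideanSpace ℝ (Fin 3))))) :=
    (by fun_prop : Measurable fun ω' : sphere (0 : EuclideanSpace ℝ (Fin 3)) 1 =>
      max ⟪(ω' : EuclideanSpace ℝ (Fin 3)), e⟫_ℝ 0).ennreal_ofReal.mul
        (hG'.comp (by fun_prop : Measurable fun ω' : sphere (0 : EuclideanSpace ℝ (Fin 3)) 1 =>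
          ⟪(ω' : EuclideanSpace ℝ (Fin 3)), e⟫_ℝ • (ω' : EuclideanSpace ℝ (Fin 3))))
  have hm2 : Measurable fun ω' : sphere (0 : EuclideanSpace ℝ (Fin 3)) 1 =>
      ENNReal.ofReal (max ⟪(ω' : EuclideanSpace ℝ (Fin 3)), e⟫_ℝ 0) *
        G (A (t • (e - ⟪(ω' : EuclideanSpace ℝ (Fin 3)), e⟫_ℝ • (ω' : EuclideanSpace ℝ (Fin 3))))) :=
    (by fun_prop : Measurable fun ω' : sphere (0 : EuclideanSpace ℝ (Fin 3)) 1 =>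
      max ⟪(ω' : EuclideanSpace ℝ (Fin 3)), e⟫_ℝ 0).ennreal_ofReal.mul
        (hG'.comp (by fun_prop : Measurable fun ω' : sphere (0 : EuclideanSpace ℝ (Fin 3)) 1 =>
          e - ⟪(ω' : EuclideanSpace ℝ (Fin 3)), e⟫_ℝ • (ω' : EuclideanSpace ℝ (Fin 3))))
  have eqL : ∫⁻ ω : sphere (0 : EuclideanSpace ℝ (Fin 3)) 1,
      ENNReal.ofReal (max ⟪V, (ω : EuclideanSpace ℝ (Fin 3))⟫_ℝ 0) *
        G (⟪V, (ω : EuclideanSpace ℝ (Fin 3))⟫_ℝ • (ω : EuclideanSpace ℝ (Fin 3))) ∂sphereMeasure =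
      ENNReal.ofReal t * ∫⁻ ω' : sphere (0 : EuclideanSpace ℝ (Fin 3)) 1,
        ENNReal.ofReal (max ⟪(ω' : EuclideanSpace ℝ (Fin 3)), e⟫_ℝ 0) *
          G (A (t • (⟪(ω' : EuclideanSpace ℝ (Fin 3)), e⟫_ℝ • (ω' : EuclideanSpace ℝ (Fin 3))))) ∂sphereMeasure := by
    rw [hcv (fun ω => ENNReal.ofReal (max ⟪V, (ω : EuclideanSpace ℝ (Fin 3))⟫_ℝ 0) *
      G (⟪V, (ω : EuclideanSpace ℝ (Fin 3))⟫_ℝ • (ω : EuclideanSpace ℝ (Fin 3)))), ← lintegral_const_mul _ hm1]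
    refine lintegral_congr fun ω' => ?_
    rw [hf_apply, hinnerA, hmax, h1, mul_assoc]
  have eqR : ∫⁻ ω : sphere (0 : EuclideanSpace ℝ (Fin 3)) 1,
      ENNReal.ofReal (max ⟪V, (ω : EuclideanSpace ℝ (Fin 3))⟫_ℝ 0) *
        G (V - ⟪V, (ω : EuclideanSpace ℝ (Fin 3))⟫_ℝ • (ω : EuclideanSpace ℝ (Fin 3))) ∂sphereMeasure =
      ENNReal.ofReal t * ∫⁻ ω' : sphere (0 : EuclideanSpace ℝ (Fin 3)) 1,
        ENNReal.ofReal (max ⟪(ω' : EuclideanSpace ℝ (Fin 3)), e⟫_ℝ 0) *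
          G (A (t • (e - ⟪(ω' : EuclideanSpace ℝ (Fin 3)), e⟫_ℝ • (ω' : EuclideanSpace ℝ (Fin 3))))) ∂sphereMeasure := by
    rw [hcv (fun ω => ENNReal.ofReal (max ⟪V, (ω : EuclideanSpace ℝ (Fin 3))⟫_ℝ 0) *
      G (V - ⟪V, (ω : EuclideanSpace ℝ (Fin 3))⟫_ℝ • (ω : EuclideanSpace ℝ (Fin 3)))), ← lintegral_const_mul _ hm2]
    refine lintegral_congr fun ω' => ?_
    rw [hf_apply, hinnerA, hmax, h2, mul_assoc]
  rw [eqL, eqR, lintegral_sphere_gain_exchange_axis hG']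

/-! ### Application: the two gain terms of the hard-sphere operator coincide pointwise -/

/-- **`∫ B(v - v_*, ω) U(v_*') dω = ∫ B(v - v_*, ω) U(v') dω` in `ℝ³`** (for every pair of velocities,
every weight `m` and every measurable `U ≥ 0`): under the hard-sphere kernel `((v - v_*)·ω)₊ dω`
the two post-collisional velocities of `Literature.MathematicalPhysics.KineticTheory.collide` are
equidistributed. Consequently the two gain parts `K₂' g = ∫∫ B M_* g(v')` and `K₂'' g = ∫∫ B M_* g(v_*')`
of the linearised hard-sphere operator agree pointwise in dimension `3`
(`lintegral_lintegral_hardSphere_gain_exchange`). [folklore] -/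
theorem lintegral_hardSphere_gain_exchange (v w : EuclideanSpace ℝ (Fin 3)) (m : ℝ)
    {U : EuclideanSpace ℝ (Fin 3) → ℝ≥0∞} (hU : Measurable U) :
    ∫⁻ ω : sphere (0 : EuclideanSpace ℝ (Fin 3)) 1,
        ENNReal.ofReal (hardSphereKernel (v, w) ω * m) * U (collide ω (v, w)).2 ∂sphereMeasure =
      ∫⁻ ω : sphere (0 : EuclideanSpace ℝ (Fin 3)) 1,
        ENNReal.ofReal (hardSphereKernel (v, w) ω * m) * U (collide ω (v, w)).1 ∂sphereMeasure := by
  have hG : Measurable fun y : EuclideanSpace ℝ (Fin 3) => U (w + y) := hU.comp (measurable_const_add w)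
  have h := lintegral_sphere_gain_exchange (v - w) hG
  simp only [hardSphereKernel, collide]
  have hpt : ∀ ω : sphere (0 : EuclideanSpace ℝ (Fin 3)) 1,
      ENNReal.ofReal (max ⟪v - w, (ω : EuclideanSpace ℝ (Fin 3))⟫_ℝ 0 * m) =
        ENNReal.ofReal m * ENNReal.ofReal (max ⟪v - w, (ω : EuclideanSpace ℝ (Fin 3))⟫_ℝ 0) := fun ω => by
    rw [ENNReal.ofReal_mul (le_max_right _ _), mul_comm]
  have hsub : ∀ ω : sphere (0 : EuclideanSpace ℝ (Fin 3)) 1,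
      v - ⟪v - w, (ω : EuclideanSpace ℝ (Fin 3))⟫_ℝ • (ω : EuclideanSpace ℝ (Fin 3)) =
        w + (v - w - ⟪v - w, (ω : EuclideanSpace ℝ (Fin 3))⟫_ℝ • (ω : EuclideanSpace ℝ (Fin 3))) :=
    fun ω => by abel
  simp_rw [hpt, hsub, mul_assoc]
  rw [lintegral_const_mul' _ _ ENNReal.ofReal_ne_top, lintegral_const_mul' _ _ ENNReal.ofReal_ne_top, h]

/-- **The two gain terms of the three-dimensional hard-sphere operator coincide pointwise**:
`∫∫ B(v - v_*, ω) m(v_*) U(v_*') dω dμ(v_*) = ∫∫ B(v - v_*, ω) m(v_*) U(v') dω dμ(v_*)` for every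
`v`, weight `m`, measure `μ` and measurable `U ≥ 0` (e.g. `m = M`, `μ =` Lebesgue: the gain parts
`K₂''` and `K₂'` of Grad's splitting of the linearised hard-sphere operator, CIP 1994 §7.2 (2.14)).
[folklore] -/
theorem lintegral_lintegral_hardSphere_gain_exchange (v : EuclideanSpace ℝ (Fin 3))
    (m : EuclideanSpace ℝ (Fin 3) → ℝ) (μ : Measure (EuclideanSpace ℝ (Fin 3)))
    {U : EuclideanSpace ℝ (Fin 3) → ℝ≥0∞} (hU : Measurable U) :
    ∫⁻ w, ∫⁻ ω : sphere (0 : EuclideanSpace ℝ (Fin 3)) 1,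
        ENNReal.ofReal (hardSphereKernel (v, w) ω * m w) * U (collide ω (v, w)).2 ∂sphereMeasure ∂μ =
      ∫⁻ w, ∫⁻ ω : sphere (0 : EuclideanSpace ℝ (Fin 3)) 1,
        ENNReal.ofReal (hardSphereKernel (v, w) ω * m w) * U (collide ω (v, w)).1 ∂sphereMeasure ∂μ :=
  lintegral_congr fun w => lintegral_hardSphere_gain_exchange v w (m w) hU

end

end Literature.MathematicalPhysics.KineticTheory
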